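import Literature.NumberTheory.DiophantineGeometry.SliceRepresentation
import Mathlib.LinearAlgebra.Trace
import Mathlib.LinearAlgebra.TensorProduct.Basis
import HarnessLib

/-!
# The symmetric square of a slice representation and its character

For a finite set `α`, a field `k`, a representation `ρ` of a group `G` on `k^α` and a stable
subspace `Y ≤ k^α`, the file `SliceRepresentation` identifies `Y ⊗ Y` with the space
`sliceSubmodule Y Y` of functions `F : α × α → k` with all partial functions in `Y`. This file
adds the swap of the two variables and the subspace `symSlice Y` of SYMMETRIC such functions
(`F (b, a) = F (a, b)`), the coordinate form of the symmetric square `Sym² Y ⊆ Y ⊗ Y`, stable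
under `pairRep ρ ρ`, and proves the character formula of the symmetric square in the form

* `two_mul_character_symSlice`: `2 · χ_{symSlice Y}(g) = χ_Y(g)² + χ_Y(g²)`.

This is Fulton–Harris, *Representation Theory*, §2.1, Exercise 2.2 (`χ_{Sym²V}(g) =
(χ_V(g)² + χ_V(g²))/2`, next to Prop. 2.1), proved here without eigenvalues: for an involution `θ` commuting with
an endomorphism `f`, `2 · tr(f|_{V^θ}) = tr f + tr (f ∘ θ)` (`two_mul_trace_restrict_of_involutive`,
through the projector `1 + θ`), and `tr((f ⊗ g) ∘ comm) = tr(f ∘ g)` (`trace_map_comp_comm`, a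
matrix computation in a product basis), applied to the swap on `Y ⊗ Y ≃ sliceSubmodule Y Y`.
It is used downstream (`PowerTraceOrbitBound`) for the symmetric Kronecker coefficients
`sk(λ, μ) = dim Hom_{𝔖_D}([λ], S²[μ])` of Gesmundo–Ikenmeyer–Panova (2017), §2.1 and Thm. 24.

## References

* W. Fulton, J. Harris, *Representation Theory. A First Course*, GTM 129 (1991), §2.1 (Prop. 2.1,
  Exercise 2.2: characters of exterior and symmetric squares; held copy p. 13). [FultonHarrisGTM129]
* F. Gesmundo, C. Ikenmeyer, G. Panova, *Geometric complexity theory and matrix powering*,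
  Diff. Geom. Appl. 55 (2017) 106–127 = arXiv:1611.00827, §2.1 (`S²[λ]`, symmetric Kronecker
  coefficients), Thm. 24. [GesmundoIkenmeyerPanova2017]

## Mathlib

Used: `LinearMap.trace` (`trace_eq_matrix_trace`, `trace_comp_comm'`), `LinearMap.toMatrix`,
`Module.Basis.tensorProduct`, `TensorProduct.comm`, `TensorProduct.map`, `LinearEquiv.conj`,
`Representation.subrepresentation`, `Representation.character`, `Representation.char_iso`,
`Representation.char_tensor`. Mathlib has no symmetric square of a representation and no
character formula for it.

## Design

`namespace Literature.NumberTheory.DiophantineGeometry`. The trace lemmas about tensor products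
and subtypes are stated at the `AddCommMonoid` level where they are applied to
`TensorProduct`/`Submodule` carriers (`trace_equiv_conj`): the `AddCommGroup`-level Mathlib
lemmas (`LinearMap.trace_conj'`) do not unify with the monoid instances carried by
`Representation.tprod` and `Representation.subrepresentation`.
-/

noncomputable section

open scoped BigOperators TensorProduct

namespace Literature.NumberTheory.DiophantineGeometry

/-! ### Two trace lemmas -/

section General

variable {k V : Type*} [Field k] [AddCommGroup V] [Module k V]

/-- **Trace on the fixed space of an involution.** For an endomorphism `f` and an involution `θ`
of a finite-dimensional space, if the fixed space `W = V^θ` is `f`-stable then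
`2 · tr(f|_W) = tr f + tr(f ∘ θ)`: the map `p = 1 + θ : V → W` satisfies `p ∘ ι = 2` on `W` and
`ι ∘ p = 1 + θ`, and `tr(f ∘ ι ∘ p) = tr(p ∘ f ∘ ι)`. (The mechanism behind
`χ_{Sym²V} = (χ_V(g)² + χ_V(g²))/2`, Fulton–Harris §2.1.) [folklore] -/
theorem two_mul_trace_restrict_of_involutive [FiniteDimensional k V] (f θ : V →ₗ[k] V)
    (hθ : ∀ v, θ (θ v) = v) (W : Submodule k V) (hW : ∀ v, v ∈ W ↔ θ v = v)
    (hfW : ∀ v ∈ W, f v ∈ W) :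
    2 * LinearMap.trace k W (f.restrict hfW) =
      LinearMap.trace k V f + LinearMap.trace k V (f ∘ₗ θ) := by
  have hs : ∀ v, ((LinearMap.id : V →ₗ[k] V) + θ) v ∈ W := fun v => by
    rw [hW, LinearMap.add_apply, LinearMap.id_apply, map_add, hθ, add_comm]
  set p : V →ₗ[k] W := ((LinearMap.id : V →ₗ[k] V) + θ).codRestrict W hs with hp
  have h1 : f + f ∘ₗ θ = (f ∘ₗ W.subtype) ∘ₗ p := by
    ext v
    simp [hp]
  have h2 : p ∘ₗ (f ∘ₗ W.subtype) = (2 : k) • f.restrict hfW := by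
    refine LinearMap.ext fun w => Subtype.ext ?_
    simp only [hp, LinearMap.comp_apply, LinearMap.codRestrict_apply, LinearMap.add_apply,
      LinearMap.id_apply, Submodule.subtype_apply, two_smul]
    rw [(hW _).mp (hfW _ w.2)]
    rfl
  rw [← map_add, h1, LinearMap.trace_comp_comm', h2, map_smul, smul_eq_mul]

/-- **Trace of a twisted tensor square**: `tr((f ⊗ g) ∘ comm) = tr(f ∘ g)` on `V ⊗ V` (in a
product basis the diagonal entry of `(f ⊗ g) ∘ comm` at `(i, j)` is `f_{ij} g_{ji}`). With
`f = g = ρ(h)` this is the term `χ_V(h²)` of the symmetric-square character, Fulton–Harris §2.1.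
[folklore] -/
theorem trace_map_comp_comm [FiniteDimensional k V] (f g : V →ₗ[k] V) :
    LinearMap.trace k (V ⊗[k] V)
        (TensorProduct.map f g ∘ₗ (TensorProduct.comm k V V).toLinearMap) =
      LinearMap.trace k V (f ∘ₗ g) := by
  classical
  set b := Module.finBasis k V with hb
  rw [LinearMap.trace_eq_matrix_trace k (b.tensorProduct b), LinearMap.trace_eq_matrix_trace k b,
    LinearMap.toMatrix_comp b b b, Matrix.trace, Matrix.trace, Fintype.sum_prod_type]
  simp only [Matrix.diag_apply, Matrix.mul_apply, LinearMap.toMatrix_apply,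
    Module.Basis.tensorProduct_apply, LinearMap.comp_apply, LinearEquiv.coe_coe,
    TensorProduct.comm_tmul, TensorProduct.map_tmul, Module.Basis.tensorProduct_repr_tmul_apply,
    smul_eq_mul]
  refine Finset.sum_congr rfl fun i _ => Finset.sum_congr rfl fun j _ => ?_
  ring

/-- **Trace is invariant under conjugation by a linear equivalence**, stated at the
`AddCommMonoid` level and proved through a basis `b` of the source (the matrix of
`e ∘ f ∘ e⁻¹` in the basis `b.map e` is the matrix of `f` in `b`). [folklore] -/
theorem trace_equiv_conj {R M N : Type*} [CommSemiring R] [AddCommMonoid M] [Module R M]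
    [AddCommMonoid N] [Module R N] {ι : Type*} [Fintype ι] [DecidableEq ι]
    (b : Module.Basis ι R M) (e : M ≃ₗ[R] N) (f : M →ₗ[R] M) :
    LinearMap.trace R N (((e : M →ₗ[R] N) ∘ₗ f) ∘ₗ (e.symm : N →ₗ[R] M)) =
      LinearMap.trace R M f := by
  rw [LinearMap.trace_eq_matrix_trace R (b.map e), LinearMap.trace_eq_matrix_trace R b]
  congr 1
  ext i j
  simp [LinearMap.toMatrix_apply]

end General

/-! ### Symmetric functions of pairs with slices in `Y` -/

section SymSlice

variable {k : Type*} [Field k] {α : Type*} [Fintype α] [DecidableEq α]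
  (Y : Submodule k (α → k))

/-- The swap of the two variables on the slice space `sliceSubmodule Y Y` (`F ↦ F ∘ swap`;
partial functions in the first variable become partial functions in the second), the coordinate
form of `TensorProduct.comm` on `Y ⊗ Y` (`sliceEquiv_comm`). Fulton–Harris §1.1, §2.1.
[folklore] -/
def sliceSwap : sliceSubmodule Y Y →ₗ[k] sliceSubmodule Y Y where
  toFun F := ⟨fun p => (F : α × α → k) p.swap, F.2.2, F.2.1⟩
  map_add' _ _ := rfl
  map_smul' _ _ := rfl

omit [Fintype α] [DecidableEq α] in
/-- Unfolding lemma for `sliceSwap`. [folklore] -/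
@[simp]
theorem coe_sliceSwap_apply (F : sliceSubmodule Y Y) (p : α × α) :
    (sliceSwap Y F : α × α → k) p = (F : α × α → k) p.swap :=
  rfl

omit [Fintype α] [DecidableEq α] in
/-- The swap is an involution. [folklore] -/
theorem sliceSwap_sliceSwap (F : sliceSubmodule Y Y) : sliceSwap Y (sliceSwap Y F) = F :=
  Subtype.ext (funext fun p => by simp)

omit [DecidableEq α] in
/-- `sliceEquiv : Y ⊗ Y ≃ sliceSubmodule Y Y` intertwines `TensorProduct.comm` with the swap of
the variables. Fulton–Harris §1.1. [folklore] -/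
theorem sliceEquiv_comm (t : Y ⊗[k] Y) :
    sliceEquiv Y Y (TensorProduct.comm k Y Y t) = sliceSwap Y (sliceEquiv Y Y t) := by
  induction t using TensorProduct.induction_on with
  | zero => simp
  | tmul y x =>
    apply Subtype.ext
    funext p
    rw [TensorProduct.comm_tmul, coe_sliceEquiv, coe_sliceSwap_apply, coe_sliceEquiv,
      sliceMap_tmul, sliceMap_tmul, Prod.fst_swap, Prod.snd_swap, mul_comm]
  | add s t hs ht => rw [map_add, map_add, map_add, map_add, hs, ht]

/-- The **symmetric slice functions**: functions `F : α × α → k` with all partial functions in `Y`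
and `F (b, a) = F (a, b)` — the coordinate form of the symmetric square `Sym² Y ⊆ Y ⊗ Y`, as a
subspace of all functions of pairs (so that `sliceRep` machinery applies to it as the second
factor). Fulton–Harris §2.1 (`Sym²V`); Gesmundo–Ikenmeyer–Panova §2.1 (`S²[λ]`, "the space of
`ℤ₂` invariants in `[λ] ⊗ [λ]`"). [cite: GesmundoIkenmeyerPanova2017, §2.1 (S²[λ])] -/
def symSlice : Submodule k (α × α → k) where
  carrier := {F | F ∈ sliceSubmodule Y Y ∧ ∀ p : α × α, F p.swap = F p}
  add_mem' hF hG := ⟨(sliceSubmodule Y Y).add_mem hF.1 hG.1, fun p => by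
    rw [Pi.add_apply, Pi.add_apply, hF.2, hG.2]⟩
  zero_mem' := ⟨(sliceSubmodule Y Y).zero_mem, fun _ => rfl⟩
  smul_mem' c _ hF := ⟨(sliceSubmodule Y Y).smul_mem c hF.1, fun p => by
    rw [Pi.smul_apply, Pi.smul_apply, hF.2]⟩

omit [Fintype α] [DecidableEq α] in
/-- Membership in `symSlice` (unfolding lemma). [folklore] -/
theorem mem_symSlice_iff (F : α × α → k) :
    F ∈ symSlice Y ↔ F ∈ sliceSubmodule Y Y ∧ ∀ p : α × α, F p.swap = F p :=
  Iff.rfl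

variable {G : Type*} [Group G] {ρ : Representation k G (α → k)} {Y}
  (hY : ∀ g, Y ≤ Y.comap (ρ g))

/-- `pairRep ρ ρ` commutes with the swap of the variables: `g · (F ∘ swap) = (g · F) ∘ swap`.
[folklore] -/
theorem pairRep_swap (g : G) (F : α × α → k) (p : α × α) :
    pairRep ρ ρ g (fun q => F q.swap) p = pairRep ρ ρ g F p.swap := by
  rw [pairRep_apply_apply, pairRep_apply_apply]
  refine Fintype.sum_equiv (Equiv.prodComm α α) _ _ fun q => ?_
  simp only [Equiv.prodComm_apply, Prod.fst_swap, Prod.snd_swap]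
  ring

include hY in
/-- The symmetric slice functions are stable under `pairRep ρ ρ` when `Y` is `ρ`-stable.
[folklore] -/
theorem symSlice_le_comap (g : G) : symSlice Y ≤ (symSlice Y).comap (pairRep ρ ρ g) := by
  intro F hF
  refine ⟨sliceSubmodule_le_comap_pairRep hY hY g hF.1, fun p => ?_⟩
  rw [← pairRep_swap, show (fun q : α × α => F q.swap) = F from funext hF.2]

/-- The swap commutes with the slice representation. [folklore] -/
theorem sliceRep_sliceSwap (g : G) (F : sliceSubmodule Y Y) :
    sliceRep hY hY g (sliceSwap Y F) = sliceSwap Y (sliceRep hY hY g F) := by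
  apply Subtype.ext
  funext p
  rw [coe_sliceRep_apply, coe_sliceSwap_apply, coe_sliceRep_apply]
  exact pairRep_swap g _ p

/-- The fixed space of the swap inside the slice space (the symmetric square of `Y` as a
subspace of `sliceSubmodule Y Y ≃ Y ⊗ Y`). Fulton–Harris §2.1. [folklore] -/
def sliceFixed : Submodule k (sliceSubmodule Y Y) where
  carrier := {F | sliceSwap Y F = F}
  add_mem' {a b} ha hb := by
    change sliceSwap Y (a + b) = a + b
    rw [map_add, ha, hb]
  zero_mem' := by change sliceSwap Y 0 = 0; rw [map_zero]
  smul_mem' c {a} ha := by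
    change sliceSwap Y (c • a) = c • a
    rw [map_smul, ha]

omit [Fintype α] [DecidableEq α] in
/-- Membership in `sliceFixed` (unfolding lemma). [folklore] -/
theorem mem_sliceFixed_iff (F : sliceSubmodule Y Y) :
    F ∈ sliceFixed (Y := Y) ↔ sliceSwap Y F = F :=
  Iff.rfl

/-- The fixed space of the swap is stable under the slice representation. [folklore] -/
theorem sliceFixed_le_comap (g : G) :
    sliceFixed (Y := Y) ≤ (sliceFixed (Y := Y)).comap (sliceRep hY hY g) := fun F hF => by
  rw [Submodule.mem_comap, mem_sliceFixed_iff, ← sliceRep_sliceSwap, (mem_sliceFixed_iff _).mp hF]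

variable (Y) in
/-- `symSlice Y ≃ sliceFixed`: a symmetric slice function is a swap-fixed element of the slice
space (tautological repackaging, linear). [folklore] -/
def symSliceEquivFixed : symSlice Y ≃ₗ[k] sliceFixed (Y := Y) where
  toFun F := ⟨⟨(F : α × α → k), F.2.1⟩, Subtype.ext (funext fun p => F.2.2 p)⟩
  invFun F := ⟨((F : sliceSubmodule Y Y) : α × α → k), (F : sliceSubmodule Y Y).2,
    fun p => congr_fun (congrArg Subtype.val F.2) p⟩
  map_add' _ _ := rfl
  map_smul' _ _ := rfl
  left_inv _ := rfl
  right_inv _ := rfl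

/-- `symSliceEquivFixed` conjugates the restriction of `pairRep ρ ρ` to `symSlice Y` into the
restriction of `sliceRep` to the swap-fixed space. [folklore] -/
theorem conj_symSliceEquivFixed (g : G) :
    (symSliceEquivFixed Y).conj
        ((pairRep ρ ρ).subrepresentation (symSlice Y) (symSlice_le_comap hY) g) =
      (sliceRep hY hY).subrepresentation (sliceFixed (Y := Y)) (sliceFixed_le_comap hY) g := by
  rw [LinearEquiv.conj_apply]
  exact LinearMap.ext fun _ => rfl

/-- **Character of the symmetric square (coordinate form).** For a `ρ`-stable `Y ≤ k^α` and the
representation of `G` on the symmetric slice functions `symSlice Y` (restriction of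
`pairRep ρ ρ`), `2 · χ_{symSlice Y}(g) = χ_Y(g)² + χ_Y(g²)`: the involution lemma on
`sliceSubmodule Y Y ≃ Y ⊗ Y` (`χ_{Y ⊗ Y} = χ_Y²`, `Representation.char_tensor`), where the swap is
`TensorProduct.comm` (`sliceEquiv_comm`) and `tr((ρ(g) ⊗ ρ(g)) ∘ comm) = tr(ρ(g)²) = χ_Y(g²)`
(`trace_map_comp_comm`). Fulton–Harris §2.1, Exercise 2.2 (with Prop. 2.1):
`χ_{Sym²V}(g) = ½(χ_V(g)² + χ_V(g²))`. [cite: FultonHarrisGTM129, §2.1 Exercise 2.2] -/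
theorem two_mul_character_symSlice (g : G) :
    2 * ((pairRep ρ ρ).subrepresentation (symSlice Y) (symSlice_le_comap hY)).character g =
      (ρ.subrepresentation Y hY).character g ^ 2 +
        (ρ.subrepresentation Y hY).character (g * g) := by
  -- transport to the fixed space of the swap inside the slice space
  have h0 : ((pairRep ρ ρ).subrepresentation (symSlice Y) (symSlice_le_comap hY)).character g =
      LinearMap.trace k _ ((sliceRep hY hY).subrepresentation (sliceFixed (Y := Y))
        (sliceFixed_le_comap hY) g) := by
    rw [Representation.character, ← conj_symSliceEquivFixed hY g, LinearEquiv.conj_apply,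
      trace_equiv_conj (Module.finBasis k _)]
  -- the involution lemma on the slice space
  have hfix : ∀ F : sliceSubmodule Y Y, F ∈ sliceFixed (Y := Y) ↔ sliceSwap Y F = F :=
    fun F => Iff.rfl
  have key := two_mul_trace_restrict_of_involutive (sliceRep hY hY g) (sliceSwap Y)
    (sliceSwap_sliceSwap Y) (sliceFixed (Y := Y)) hfix
    (fun F hF => sliceFixed_le_comap hY g hF)
  rw [h0, Representation.subrepresentation_apply, key]
  -- first trace: `χ_{Y ⊗ Y} = χ_Y²`
  have h1 : LinearMap.trace k _ (sliceRep hY hY g) =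
      (ρ.subrepresentation Y hY).character g * (ρ.subrepresentation Y hY).character g := by
    have := Representation.char_iso (V := ↥Y ⊗[k] ↥Y) (sliceRepEquiv hY hY)
    rw [Representation.char_tensor] at this
    exact (congr_fun this g).symm
  -- second trace: transport to `Y ⊗ Y`, where the swap is `TensorProduct.comm`
  have h2 : LinearMap.trace k _ (sliceRep hY hY g ∘ₗ sliceSwap Y) =
      (ρ.subrepresentation Y hY).character (g * g) := by
    set e := (sliceRepEquiv hY hY).toLinearEquiv with he
    have hconj : sliceRep hY hY g ∘ₗ sliceSwap Y =
        ((e : _ →ₗ[k] _) ∘ₗ (TensorProduct.map (ρ.subrepresentation Y hY g)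
          (ρ.subrepresentation Y hY g) ∘ₗ (TensorProduct.comm k Y Y).toLinearMap)) ∘ₗ
          (e.symm : _ →ₗ[k] _) := by
      refine LinearMap.ext fun F => ?_
      obtain ⟨t, rfl⟩ := e.surjective F
      simp only [LinearMap.comp_apply, LinearEquiv.coe_coe, e.symm_apply_apply]
      apply Subtype.ext
      change pairRep ρ ρ g (sliceSwap Y (sliceEquiv Y Y t) : α × α → k) =
        (sliceEquiv Y Y (((ρ.subrepresentation Y hY).tprod (ρ.subrepresentation Y hY)) g
          (TensorProduct.comm k Y Y t)) : α × α → k)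
      rw [← sliceEquiv_comm, coe_sliceEquiv, coe_sliceEquiv, pairRep_sliceMap hY hY,
        Representation.tprod_apply]
    rw [hconj, trace_equiv_conj ((Module.finBasis k Y).tensorProduct (Module.finBasis k Y)),
      trace_map_comp_comm, ← Module.End.mul_eq_comp, ← map_mul]
    rfl
  rw [h1, h2, sq]

end SymSlice

end Literature.NumberTheory.DiophantineGeometry
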